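import Summits.ResolutionOfSingularities.ResolutionOfSingularities.Theorems.WeightedInvariantHypersurfaceLocalGameEFTPointMoveChart
import Summits.ResolutionOfSingularities.ResolutionOfSingularities.Theorems.WeightedInvariantIota3IsoSuccInitialForm
import Summits.ResolutionOfSingularities.ResolutionOfSingularities.Theorems.WeightedInvariantIota3FlagBridge
import Summits.ResolutionOfSingularities.ResolutionOfSingularities.Theorems.WeightedInvariantP3aTieLocusPin
import HarnessLib

/-!
# Point moves V: LIFTING a weighted-homogeneous polynomial of the exceptional chart back to `S`, and the pure-power congruence
# `f − c·L^ν ∈ 𝒥_{mν+1}` (door `HypersurfaceCentreConstruction`, stmt-ResolutionOfSingularities-19897; stub `stub_keyRungGrHomLE_three`,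
# residual (D-b³-point-STAT); (iso-succ) PART C programme, S-side half of the bridge)

Topic: `Summits/ResolutionOfSingularities/ResolutionOfSingularities/Theorems`.  DEF-FREE.  Helper `--supports stmt-ResolutionOfSingularities-19897`.

Setting of …PointMoveChart (`S` regular local, `u : Fin d → S` a regular system of parameters, positive weights `w`, `B = S[t⁻¹, 𝒥ₙtⁿ]`,
`ρ : B ↠ κ[X] = B ⧸ (t⁻¹)`).  (iso-succ) PART A″ (…IsoSuccHeightOne, p838395) hands back, from an order-stationary curve of the weighted plane,
`ρ(g) = c·G^ν` with `G` weighted-homogeneous of degree `w j` and `G.coeff X_j ≠ 0`.  To contradict σ-maximality ON `S` one needs an `S`-avatar of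
`G`.  This file supplies it:

* `exists_lift_of_isWeightedHomogeneous` — every `G ∈ κ[X]` weighted-homogeneous of degree `e` LIFTS: there are `L ∈ 𝒥_e(u) ⊆ S` and `L' ∈ B`
  with `ρ(L') = G` and `L = (t⁻¹)^e · L'` in `B` (coefficientwise lift of `G`, then …PointMoveChart's `transform` with zero remainder); moreover for
  every slot `j` of weight `e` at which `G` has a NON-ZERO LINEAR coefficient, `u_j − c·L ∈ 𝒥_e(u[j ↦ 0])` for a unit `c` (all other monomials of
  weight `e = w_j` avoid the slot `j`) — the shape of a SLOT REPLACEMENT (…KWildHomSlotReplace).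
* `mem_weightedMonomialIdeal_of_algebraMap_eq_tInv_pow_mul` — `S ∩ (t⁻¹)ⁿB = 𝒥ₙ`: `a = (t⁻¹)ⁿ·b` in `B` forces `a ∈ 𝒥ₙ(u)`.
* **`sub_mul_pow_mem_of_rho_eq`** — if `f = (t⁻¹)^{eν}·g` in `B` and `ρ(g) = c̄·G^ν` then, for the lift `L` of `G` and any lift `c` of `c̄`,
  `f − c·L^ν ∈ 𝒥_{eν+1}(u)` (the difference `g − c·L'^ν` dies under `ρ`, so it is a multiple of `t⁻¹`).
* `weightedMonomialIdeal_le_flagContactFiltration_of_forall_mem` — DOMINANCE: if every `v_i` lies in level `w'_i` of a two-flag filtration `F`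
  (parameter `q > 0`), then `𝒥ₙ(v; w') ⊆ Fₙ` for all `n` (multiplicativity `F_a·F_b ⊆ F_{a+b}` of …FlagBridge).

[OURS · L1 W4.3 · folklore weighted-filtration bookkeeping; AI work, weaker than expert review; nothing here is a statement of the manuscript under
review (Hironaka 2017, [claim: Hironaka2017, status: under-review]).]

## References

* J. Włodarczyk, *Functorial resolution by torus actions*, arXiv:2203.03090, §2.3.9, §3.3, Lemma 4.1.7. [Wlodarczyk2022]
-/

noncomputable section

open IsLocalRing Literature.AlgebraicGeometry.Resolution MvPolynomial
open scoped LaurentPolynomial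
open Summit.ResolutionOfSingularities.ResolutionOfSingularities.Cruxes.HypersurfaceCentreConstruction.LocalEngine.Iota3
  (flagContactFiltration flagContactFiltration_zero flagContactFiltration_antitone flagContactFiltration_mul_le
    pow_le_flagContactFiltration_mul C_mul_prod_X_pow_eq_monomial weight_equivFunOnFinite_symm)

set_option linter.dupNamespace false -- mandated namespace of this single-conjunct summit

namespace Summit.ResolutionOfSingularities.ResolutionOfSingularities.Theorems

namespace LocalGameEFTPointMove

/-! ## Dominance of a weighted monomial filtration by a two-flag filtration -/

section Dominance

variable {S : Type} [CommRing S] [IsLocalRing S] {d : ℕ}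

/-- **DOMINANCE**: if `v_i ∈ F_{w'_i}(G₁, G₂; q, r₁, r₂)` for all `i` (`q > 0`), then `𝒥ₙ(v; w') ⊆ Fₙ(G₁, G₂; q, r₁, r₂)` for every `n`.
[folklore] -/
theorem weightedMonomialIdeal_le_flagContactFiltration_of_forall_mem (v : Fin d → S) (w' : Fin d → ℕ) (G₁ G₂ : S) {q r₁ r₂ : ℕ}
    (hq : 0 < q) (hv : ∀ i, v i ∈ flagContactFiltration G₁ G₂ q r₁ r₂ (w' i)) (n : ℕ) :
    weightedMonomialIdeal v w' n ≤ flagContactFiltration G₁ G₂ q r₁ r₂ n := by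
  classical
  rw [weightedMonomialIdeal, Ideal.span_le]
  rintro _ ⟨α, hα, rfl⟩
  rw [SetLike.mem_coe]
  refine flagContactFiltration_antitone G₁ G₂ q r₁ r₂ hα ?_
  -- `∏_{i ∈ s} v_i^{α_i} ∈ F(Σ_{i ∈ s} w'_i α_i)` by induction on `s`
  suffices h : ∀ s : Finset (Fin d), ∏ i ∈ s, v i ^ α i ∈ flagContactFiltration G₁ G₂ q r₁ r₂ (∑ i ∈ s, w' i * α i) from
    h Finset.univ
  intro s
  induction s using Finset.induction_on with
  | empty =>
    rw [Finset.prod_empty, Finset.sum_empty, flagContactFiltration_zero G₁ G₂ q r₁ r₂ hq]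
    exact Submodule.mem_top
  | insert i s hi ih =>
    rw [Finset.prod_insert hi, Finset.sum_insert hi]
    have hpow : v i ^ α i ∈ flagContactFiltration G₁ G₂ q r₁ r₂ (w' i * α i) := by
      have h := Ideal.pow_mem_pow (hv i) (α i)
      exact pow_le_flagContactFiltration_mul G₁ G₂ r₁ r₂ hq (w' i) (α i) h
    exact flagContactFiltration_mul_le G₁ G₂ q r₁ r₂ hq _ _ (Ideal.mul_mem_mul hpow ih)

end Dominance

/-! ## `S ∩ (t⁻¹)ⁿ B = 𝒥ₙ` -/

section Saturation

variable {S : Type} [CommRing S] {d : ℕ} (u : Fin d → S) (w : Fin d → ℕ)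

/-- **`S ∩ (t⁻¹)ⁿ·B = 𝒥ₙ(u)`**: if `a = (t⁻¹)ⁿ · b` in the cobordant algebra then `a ∈ 𝒥ₙ(u)` (the Laurent coefficient of `b` at `tⁿ`).
[cite: Wlodarczyk2022, §3.3] (folklore rendering) -/
theorem mem_weightedMonomialIdeal_of_algebraMap_eq_tInv_pow_mul {a : S} {n : ℕ} {b : extReesAlgebra (weightedMonomialIdeal u w)}
    (h : algebraMap S (extReesAlgebra (weightedMonomialIdeal u w)) a = extReesAlgebra.tInv (weightedMonomialIdeal u w) ^ n * b) :
    a ∈ weightedMonomialIdeal u w n := by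
  refine LocalGameEFTCylinder.mem_weightedMonomialIdeal_of_coe_eq u w (b := b) (a := a) ?_
  have h' := congrArg Subtype.val h
  rw [Subalgebra.coe_algebraMap, ← LaurentPolynomial.C_eq_algebraMap, Subalgebra.coe_mul, Subalgebra.coe_pow,
    extReesAlgebra.coe_tInv, LaurentPolynomial.T_pow] at h'
  -- multiply `C a = T(-n) · b` by `T n`
  have h2 : LaurentPolynomial.C a * LaurentPolynomial.T (n : ℤ) =
      LaurentPolynomial.T ((n : ℤ) * -1) * (b : S[T;T⁻¹]) * LaurentPolynomial.T (n : ℤ) := by rw [h']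
  rw [mul_right_comm, ← LaurentPolynomial.T_add, show ((n : ℤ) * -1 + (n : ℤ)) = 0 by ring, LaurentPolynomial.T_zero, one_mul] at h2
  exact h2.symm

end Saturation

/-! ## Lifting a weighted-homogeneous polynomial of the exceptional chart -/

section Exponents

variable {S : Type} [CommRing S] {d : ℕ} (w : Fin d → ℕ) (hw : ∀ i, 0 < w i)

/-- `∏ᵢ uᵢ ^ (e_j)ᵢ = u_j`. [folklore] -/
theorem prod_pow_single (v : Fin d → S) (j : Fin d) : ∏ i, v i ^ (Pi.single j 1 : Fin d → ℕ) i = v j := by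
  rw [Finset.prod_eq_single j (fun i _ hi => by rw [Pi.single_eq_of_ne hi, pow_zero]) (fun h => absurd (Finset.mem_univ j) h),
    Pi.single_eq_same, pow_one]

include hw in
/-- With positive weights, an exponent of weight `w j` other than `e_j` AVOIDS the slot `j`. [folklore] -/
theorem apply_eq_zero_of_weight_eq_of_ne {α : Fin d → ℕ} {j : Fin d} (hα : ∑ i, w i * α i = w j) (hne : α ≠ Pi.single j 1) : α j = 0 := by
  classical
  by_contra hj
  have hj1 : 1 ≤ α j := Nat.one_le_iff_ne_zero.mpr hj
  have hsplit : ∑ i, w i * α i = w j * α j + ∑ i ∈ Finset.univ.erase j, w i * α i :=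
    (Finset.add_sum_erase _ _ (Finset.mem_univ j)).symm
  have hP : w j ≤ w j * α j := Nat.le_mul_of_pos_right _ hj1
  have hrest : ∑ i ∈ Finset.univ.erase j, w i * α i = 0 ∧ w j * α j = w j := by
    set P := w j * α j with hPdef
    set R := ∑ i ∈ Finset.univ.erase j, w i * α i with hRdef
    omega
  have hαj : α j = 1 := Nat.eq_of_mul_eq_mul_left (hw j) (by rw [mul_one]; exact hrest.2)
  apply hne
  funext i
  by_cases hi : i = j
  · subst hi; rw [Pi.single_eq_same, hαj]
  · rw [Pi.single_eq_of_ne hi]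
    have h0 := (Finset.sum_eq_zero_iff.mp hrest.1) i (Finset.mem_erase.mpr ⟨hi, Finset.mem_univ i⟩)
    exact (mul_eq_zero.mp h0).resolve_left (hw i).ne'

end Exponents

section Lift

variable {S : Type} [CommRing S] [IsRegularLocalRing S] {d : ℕ} (u : Fin d → S) (w : Fin d → ℕ)
  (hu : Ideal.span (Set.range u) = maximalIdeal S) (hd : (maximalIdeal S).spanFinrank = d) (hw : ∀ i, 0 < w i)

include hu hd hw in
/-- **LIFTING.**  Every `G ∈ κ[X]` (`κ = S ⧸ (u)`) weighted-homogeneous of degree `e` has an `S`-avatar: `L ∈ 𝒥_e(u)` and `L' ∈ B` with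
`ρ(L') = G`, `L = (t⁻¹)^e · L'` in `B`, and — for every slot `j` of weight `e` where `G` has a non-zero LINEAR coefficient — a unit `c` with
`u_j − c·L ∈ 𝒥_e(u[j ↦ 0])` (slot-replacement shape). [folklore · OUR (iso-succ) PART C bookkeeping] -/
theorem exists_lift_of_isWeightedHomogeneous (G : MvPolynomial (Fin d) (S ⧸ Ideal.span (Set.range u))) {e : ℕ}
    (hG : G.IsWeightedHomogeneous w e) :
    ∃ (L : S) (L' : extReesAlgebra (weightedMonomialIdeal u w)),
      rho u w hu hd hw L' = G ∧
      algebraMap S (extReesAlgebra (weightedMonomialIdeal u w)) L = extReesAlgebra.tInv (weightedMonomialIdeal u w) ^ e * L' ∧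
      L ∈ weightedMonomialIdeal u w e ∧
      ∀ j : Fin d, w j = e → G.coeff (Finsupp.single j 1) ≠ 0 →
        ∃ c : S, IsUnit c ∧ u j - c * L ∈ weightedMonomialIdeal (Function.update u j 0) w e := by
  classical
  -- coefficientwise lift
  set Δ : Finset (Fin d → ℕ) := G.support.image (fun β : Fin d →₀ ℕ => (⇑β : Fin d → ℕ)) with hΔ
  have hlift : ∀ α : Fin d → ℕ, ∃ s : S, Ideal.Quotient.mk (Ideal.span (Set.range u)) s = G.coeff (Finsupp.equivFunOnFinite.symm α) :=
    fun α => Ideal.Quotient.mk_surjective _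
  choose s hs using hlift
  have hΔmem : ∀ α ∈ Δ, ∑ i, w i * α i = e := by
    intro α hα
    obtain ⟨β, hβ, rfl⟩ := Finset.mem_image.mp hα
    have h := hG (mem_support_iff.mp hβ)
    rw [← weight_equivFunOnFinite_symm, Finsupp.equivFunOnFinite_symm_coe]
    exact h
  have hN : 0 < e + 1 := Nat.succ_pos e
  have hr : (0 : S) ∈ (maximalIdeal S) ^ (e + 1) := Ideal.zero_mem _
  set L : S := ∑ α ∈ Δ, s α * ∏ i, u i ^ α i with hL
  have hLf : L = ∑ α ∈ Δ, s α * ∏ i, u i ^ α i + 0 := by rw [add_zero]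
  refine ⟨L, transform u w hu hw Δ s e hN hr, ?_, ?_, ?_, ?_⟩
  · -- `ρ(L') = G`
    rw [rho_transform u w hu hd hw Δ s e hN hr (fun α hα => (hΔmem α hα).ge) (Nat.lt_succ_self e),
      Finset.filter_true_of_mem hΔmem, hΔ, Finset.sum_image fun β _ β' _ h => DFunLike.coe_injective h]
    conv_rhs => rw [G.as_sum]
    refine Finset.sum_congr rfl fun β _ => ?_
    rw [C_mul_prod_X_pow_eq_monomial, hs]
    simp
  · exact algebraMap_eq_tInv_pow_mul_transform u w hu hw Δ s e hN hr (fun α hα => (hΔmem α hα).ge) (Nat.le_succ e) hLf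
  · exact Ideal.sum_mem _ fun α hα => Ideal.mul_mem_left _ _ (prod_pow_mem_weightedMonomialIdeal u w α (hΔmem α hα).ge)
  · intro j hj hcoeff
    -- the coefficient at `e_j` lifts to a unit
    have hsingle : Finsupp.equivFunOnFinite.symm (Pi.single j 1 : Fin d → ℕ) = Finsupp.single j 1 := by
      rw [← Finsupp.single_eq_pi_single]; exact Finsupp.equivFunOnFinite_symm_coe _
    have hsj : s (Pi.single j 1) ∉ Ideal.span (Set.range u) := by
      intro h
      apply hcoeff
      rw [← hsingle, ← hs, Ideal.Quotient.eq_zero_iff_mem.mpr h]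
    have hunit : IsUnit (s (Pi.single j 1)) := by
      rw [hu] at hsj
      simpa [IsLocalRing.mem_maximalIdeal, mem_nonunits_iff] using hsj
    obtain ⟨c₀, hc₀⟩ := hunit
    have hmemΔ : (Pi.single j 1 : Fin d → ℕ) ∈ Δ := by
      rw [hΔ, Finset.mem_image]
      refine ⟨Finsupp.single j 1, mem_support_iff.mpr hcoeff, ?_⟩
      rw [Finsupp.single_eq_pi_single]
    refine ⟨↑c₀⁻¹, Units.isUnit _, ?_⟩
    -- `u_j − c₀⁻¹ L = − c₀⁻¹ · Σ_{α ≠ e_j} s_α u^α`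
    have hsplit : L = s (Pi.single j 1) * u j + ∑ α ∈ Δ.erase (Pi.single j 1), s α * ∏ i, u i ^ α i := by
      rw [hL, ← Finset.add_sum_erase Δ _ hmemΔ, prod_pow_single]
    have heq : u j - ↑c₀⁻¹ * L = -(↑c₀⁻¹ * ∑ α ∈ Δ.erase (Pi.single j 1), s α * ∏ i, u i ^ α i) := by
      rw [hsplit, ← hc₀, mul_add, ← mul_assoc, Units.inv_mul, one_mul]
      ring
    rw [heq]
    refine neg_mem_iff.mpr (Ideal.mul_mem_left _ _ (Ideal.sum_mem _ fun α hα => Ideal.mul_mem_left _ _ ?_))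
    obtain ⟨hne, hαΔ⟩ := Finset.mem_erase.mp hα
    have hαj : α j = 0 := apply_eq_zero_of_weight_eq_of_ne w hw ((hΔmem α hαΔ).trans hj.symm) hne
    have hprod : ∏ i, u i ^ α i = ∏ i, Function.update u j 0 i ^ α i := by
      refine Finset.prod_congr rfl fun i _ => ?_
      by_cases hi : i = j
      · subst hi; rw [hαj, pow_zero, pow_zero]
      · rw [Function.update_of_ne hi]
    rw [hprod]
    exact prod_pow_mem_weightedMonomialIdeal _ w α (hΔmem α hαΔ).ge

include hu hd hw in
/-- **THE PURE-POWER CONGRUENCE.**  If `f = (t⁻¹)^{eν} · g` in `B` and `ρ(g) = c̄ · G^ν` with `G` weighted-homogeneous of degree `e`, then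
for the lift `L` of `G` and ANY lift `c` of `c̄`: `f − c·L^ν ∈ 𝒥_{eν+1}(u)`; the lift keeps the slot-replacement clause of
`exists_lift_of_isWeightedHomogeneous`. [folklore · OUR (iso-succ) PART C bookkeeping] -/
theorem sub_mul_pow_mem_of_rho_eq (G : MvPolynomial (Fin d) (S ⧸ Ideal.span (Set.range u))) {e : ℕ}
    (hG : G.IsWeightedHomogeneous w e) {ν : ℕ} {f c : S} {g : extReesAlgebra (weightedMonomialIdeal u w)}
    (hfg : algebraMap S (extReesAlgebra (weightedMonomialIdeal u w)) f = extReesAlgebra.tInv (weightedMonomialIdeal u w) ^ (e * ν) * g)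
    (hρ : rho u w hu hd hw g = MvPolynomial.C (Ideal.Quotient.mk _ c) * G ^ ν) :
    ∃ L : S, f - c * L ^ ν ∈ weightedMonomialIdeal u w (e * ν + 1) ∧ L ∈ weightedMonomialIdeal u w e ∧
      ∀ j : Fin d, w j = e → G.coeff (Finsupp.single j 1) ≠ 0 →
        ∃ c' : S, IsUnit c' ∧ u j - c' * L ∈ weightedMonomialIdeal (Function.update u j 0) w e := by
  obtain ⟨L, L', hρL, hLL', hLJ, hslot⟩ := exists_lift_of_isWeightedHomogeneous u w hu hd hw G hG
  refine ⟨L, ?_, hLJ, hslot⟩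
  -- `g − c·L'^ν ∈ ker ρ = (t⁻¹)`
  have hker : g - algebraMap S _ c * L' ^ ν ∈ RingHom.ker (rho u w hu hd hw) := by
    rw [RingHom.mem_ker, map_sub, map_mul, map_pow, rho_algebraMap, hρL, hρ, sub_self]
  rw [ker_rho, Ideal.mem_span_singleton] at hker
  obtain ⟨h, hh⟩ := hker
  refine mem_weightedMonomialIdeal_of_algebraMap_eq_tInv_pow_mul u w (b := h) ?_
  rw [map_sub, map_mul, map_pow, hfg, hLL', mul_pow, ← pow_mul, pow_succ, mul_assoc, ← hh]
  ring

end Lift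

end LocalGameEFTPointMove

end Summit.ResolutionOfSingularities.ResolutionOfSingularities.Theorems

end
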